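import Mathlib
import Literature.Probability.Distributions.BrascampLiebCalculus
import Literature.MathematicalPhysics.QuantumFieldTheory.Balaban1983to89.T4CubePoincare
import Literature.MathematicalPhysics.QuantumFieldTheory.Balaban1983to89.T4CubeShellBlocks
import Literature.MathematicalPhysics.QuantumFieldTheory.Balaban1983to89.T4CubeShellConditional
import Literature.MathematicalPhysics.QuantumFieldTheory.Balaban1983to89.T4CubeShellDoubling


/-!
# Cube-shell conditioning VII: the local class `𝔐`, the covariance profile `κ` and the profile recursion
`κ(M) ≤ λ⁻¹ · N(m) · 2R² · κ(m)²` (`M > 2m + 3r`), with the dyadic barrier modulo one seed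

Landing edition «CubeShell VII» of the ideation cell `ym-nodeO-ideate` (seat P8, lens DUAL; memo `memos/ROUTE-p8.md`
v7.5 §94 ff., companion G9), over the landed modules I `T4CubeShellBlocks`, IV `T4CubeShellConditional` and
V `T4CubeShellDoubling` of this directory.  Sorry-free; no `axiom`; carrier `Fin n → ℝ`, window `[-S,S]ⁿ` and the
windowed Gibbs functionals `cubeMean ∕ cubeCov ∕ shellCov` of `T4CubePoincare` ∕ module I throughout.

HONEST FRAMING.  This file is an ARRANGEMENT, in the tree's windowed cube model, of three printed ingredients:
(a) the Brascamp–Lieb covariance bound [BrascampLieb1976, Thm 4.1] (tree: module I `abs_cubeCov_le`);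
(b) conditioning on a shell block = the DLR ∕ specification structure of finite-range Gibbs measures
[FriedliVelenik2017, Lemma 6.7 (6.7)–(6.10), §6.10.1 (6.110)] (tree: modules II, IV — `condPot`, `hessianBound_condPot`,
`shellCov_grad_eq_cubeCov_condPot`); (c) the Cauchy–Schwarz «doubling» composition of module V
(`abs_cubeCov_le_doubling_profile`, itself a composition of (a), (b) and the covariance-response identity
[GlimmJaffe1987, Cor. 4.3.4 (proof)]).  What is typed here is the FINITE-SIZE ∕ «effectiveness» form that these
ingredients take for UNBOUNDED continuous spins — the analogue, for the class `𝔐` below, of the discrete-spin statement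
«strong mixing verified at one scale (with a margin) holds at all scales» [Martinelli1999, §2.4 p.103, Def. 2.6
(the covariance profile `SMT(V, n, α)` at separation `n`) and Thm 2.7 (effectiveness, after [MartinelliOlivieri1994])]:
* §1 a LOCAL SPEC `Spec n` (a pseudo-metric `d` on the `n` coordinates, a range `r`, the window half-width `S`, the
  convexity constant `λ`, a Hessian-row constant `R ≥ λ`, a support budget `a ≥ sup_k #B_r(k)`), the CLASS `Spec.InClass f`
  (`f ∈ C²`, `HessianBound f λ`, `∂_k f` a function of the coordinates in `B_r(k)`, `|∇∂_k f|² ≤ R²`), admissible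
  observable pairs at separation `m` (`Spec.Adm`) and the COVARIANCE PROFILE `Spec.kappa m` = the supremum of
  `|cubeCov f S F H|` over the class and the admissible pairs (`0` adjoined); `0 ≤ κ ≤ λ⁻¹` by (a), `κ` antitone;
* §2 CLOSURE of the class under shell conditioning (`Spec.SideData`, `sideData_lo ∕ _hi`, `inClass_condPot`, `side_bound`):
  the regularised conditional potential of module IV is again in the class for the SAME spec, so the shell-indexed
  conditional covariances of module V's recursion data are bounded by `C · κ(m)` (`C = 2R` resp. `R`);
* §3 THE PROFILE RECURSION `Spec.kappa_step : 2m + 3r < M → κ(M) ≤ λ⁻¹ · (a · G(m + 2r)) · 2R² · κ(m)²`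
  (`G = Spec.growth`, the volume growth of `d`), by splitting an admissible triple along the refinement labelling
  `Spec.rlab A m` (inside `d(A,·) ≤ m + r` ∕ shell ∕ outside `d(A,·) > m + 2r`) and applying module V;
* §4 THE BARRIER `Spec.kappa_barrier`: along `s_{j+1} = 2 s_j + 3r + 1`, under geometric growth `a·G(s_j + 2r) ≤ A q^j`,
  ONE seed `c A q κ(s_0) ≤ ρ` (`c = 2R²/λ`) gives `κ(s_j) ≤ ρ^{2^j} / (c A q^{j+1})` for all `j` (`sq_barrier`:
  `b_{j+1} ≤ b_j²`); constants never see `n`;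
* §5 NON-VACUITY: specs from connected graphs (`Spec.ofGraph`, graph distance [Martinelli1999, §2.1 p.98]); the
  `λ`-Gaussian is in the class; every level is admissible (`adm_gauss_zero`).
WHAT THIS FILE DOES NOT CLAIM.  (i) The SEED is a hypothesis, not a theorem of this file ((a) alone cannot supply it,
since `R ≥ λ`).  (ii) For the class `𝔐` on the FULL space `ℝⁿ` (no window) exponential decay of the covariance profile,
uniformly in `n`, is KNOWN IN PRINT by the Helffer–Sjöstrand weighted-resolvent (Witten-Laplacian) method
[HelfferSjostrand1994] — perturbative single-site form with unit rate: [Ledoux2001, Prop. 6.2 p.190] (after Helffer) —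
so §3–§4 are a typed ALTERNATIVE route (conditioning + Brascamp–Lieb + Cauchy–Schwarz, seed explicit), not a new decay
theorem.  (iii) Nothing here is an estimate on any density of Bałaban's renormalisation programme, nor a statement about
[Balaban1987RG1] Thm 2 ∕ (0.31): the class is the WINDOWED cube model with a GLOBAL Hessian bound and FINITE range; the
effective actions of the programme are neither (caveat WINDOW ≠ PRINT of `T4CubeChartExp`; the finite-range idealisation
is this cell's memo item (D2q)).  Proofs ours; cite tags name the printed sources of the ingredients ∕ the printed analogue.
-/

set_option autoImplicit false
namespace Literature.MathematicalPhysics.QuantumFieldTheory.Balaban1983to89.T4CubeShellProfile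

open MeasureTheory Set Matrix
open Literature.MathematicalPhysics.QuantumFieldTheory.Balaban1983to89.T4CubeShellConditional
open Literature.MathematicalPhysics.QuantumFieldTheory.Balaban1983to89.T4CubeShellDoubling
open Literature.MathematicalPhysics.QuantumFieldTheory.Balaban1983to89.T4CubePoincare
open Literature.MathematicalPhysics.QuantumFieldTheory.Balaban1983to89.T4CubeShellBlocks
open Literature.Probability.Distributions
open Literature.Probability.Distributions.BrascampLiebCalculus (hasDerivAt_line continuous_coordGradient)

variable {n : ℕ}

/-! ## §0 Helpers: homogeneity of `cubeCov`, the derivative in coordinates, dependence from vanishing partials -/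

section Helpers

/-- `⟨c·G⟩_K = c·⟨G⟩_K`. [cite: Durrett2019, Thm 1.4.7 (ii)–(iii); GlimmJaffe1987, §4.3 (proof of Cor. 4.3.3)] -/
theorem cubeMean_const_mul (f : (Fin n → ℝ) → ℝ) (S : ℝ) (G : (Fin n → ℝ) → ℝ) (c : ℝ) :
    cubeMean f S (fun x => c * G x) = c * cubeMean f S G := by
  unfold cubeMean
  have e : (fun x => c * G x * Real.exp (-f x)) = fun x => c * (G x * Real.exp (-f x)) := by
    funext x; ring
  rw [e, integral_const_mul, mul_div_assoc]

/-- **Homogeneity of the cube covariance in the second insert**: `Cov_K(F, c·G) = c·Cov_K(F, G)`.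
[cite: Durrett2019, Thm 1.4.7 (ii)–(iii); GlimmJaffe1987, §4.3 (proof of Cor. 4.3.3)] -/
theorem cubeCov_const_mul_right (f : (Fin n → ℝ) → ℝ) (S : ℝ) (F G : (Fin n → ℝ) → ℝ) (c : ℝ) :
    cubeCov f S F (fun x => c * G x) = c * cubeCov f S F G := by
  unfold cubeCov
  rw [cubeMean_const_mul]
  have e : (fun x => (F x - cubeMean f S F) * (c * G x - c * cubeMean f S G) * Real.exp (-f x))
      = fun x => c * ((F x - cubeMean f S F) * (G x - cubeMean f S G) * Real.exp (-f x)) := by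
    funext x; ring
  rw [e, integral_const_mul, mul_div_assoc]

/-- `e_i`-multiples: `Pi.single i c = c • e_i`. [folklore] -/
private theorem single_eq_smul_single (i : Fin n) (c : ℝ) :
    (Pi.single i c : Fin n → ℝ) = c • (Pi.single i (1 : ℝ) : Fin n → ℝ) := by
  funext k
  by_cases hk : k = i
  · subst hk; simp
  · simp [Pi.single_eq_of_ne hk]

/-- **The derivative in coordinates**: `Dg(x) v = Σ_i v_i ∂_i g(x)` (pure linear algebra of the continuous linear
map `fderiv ℝ g x`; no differentiability needed). [cite: Spivak1965, Thm 2-7] -/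
theorem fderiv_apply_eq_sum_coordGradient (g : (Fin n → ℝ) → ℝ) (x v : Fin n → ℝ) :
    fderiv ℝ g x v = ∑ i, v i * coordGradient g x i := by
  conv_lhs => rw [← Finset.univ_sum_single v]
  rw [map_sum]
  refine Finset.sum_congr rfl fun i _ => ?_
  rw [single_eq_smul_single i (v i), map_smul, smul_eq_mul]
  rfl

/-- **Dependence from vanishing partials**: a differentiable `g` all of whose partial derivatives OFF `s` vanish
identically is a function of the coordinates in `s` (mean value theorem along the segment joining two points
that agree on `s`). [cite: Spivak1965, Thm 2-7; FriedliVelenik2017, Lemma 6.3] -/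
theorem dependsOn_of_coordGradient_eq_zero {g : (Fin n → ℝ) → ℝ} (hg : Differentiable ℝ g) {s : Set (Fin n)}
    (h : ∀ i, i ∉ s → ∀ x, coordGradient g x i = 0) : DependsOn g s := by
  intro y y' hyy'
  have hφ : ∀ t : ℝ, HasDerivAt (fun t : ℝ => g (y + t • (y' - y))) 0 t := by
    intro t
    have h1 := hasDerivAt_line hg y (y' - y) t
    have hz : fderiv ℝ g (y + t • (y' - y)) (y' - y) = 0 := by
      rw [fderiv_apply_eq_sum_coordGradient]
      refine Finset.sum_eq_zero fun i _ => ?_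
      by_cases hi : i ∈ s
      · rw [Pi.sub_apply, hyy' i hi, sub_self, zero_mul]
      · rw [h i hi, mul_zero]
    rwa [hz] at h1
  have hd : Differentiable ℝ (fun t : ℝ => g (y + t • (y' - y))) := fun t => (hφ t).differentiableAt
  have hc := is_const_of_deriv_eq_zero hd (fun t => (hφ t).deriv) 0 1
  simpa using hc

/-- `∇(c·G) = c·∇G`. [cite: Spivak1965, Thm 2-3] -/
theorem coordGradient_const_mul {G : (Fin n → ℝ) → ℝ} (hG : Differentiable ℝ G) (c : ℝ) (x : Fin n → ℝ) :
    coordGradient (fun y => c * G y) x = c • coordGradient G x := by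
  funext i
  simp only [coordGradient, Pi.smul_apply, smul_eq_mul]
  rw [fderiv_const_mul (hG x) c, FunLike.coe_smul, Pi.smul_apply, smul_eq_mul]

/-- `|∇(c·G)|² = c²|∇G|²`. [cite: Spivak1965, Thm 2-3] -/
theorem gradSq_const_mul {G : (Fin n → ℝ) → ℝ} (hG : Differentiable ℝ G) (c : ℝ) (x : Fin n → ℝ) :
    coordGradient (fun y => c * G y) x ⬝ᵥ coordGradient (fun y => c * G y) x
      = c ^ 2 * (coordGradient G x ⬝ᵥ coordGradient G x) := by
  rw [coordGradient_const_mul hG c x, smul_dotProduct, dotProduct_smul, smul_eq_mul, smul_eq_mul]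
  ring

/-- `∇(A − B) = ∇A − ∇B`. [cite: Spivak1965, Thm 2-3] -/
theorem coordGradient_sub {A B : (Fin n → ℝ) → ℝ} (hA : Differentiable ℝ A) (hB : Differentiable ℝ B)
    (x : Fin n → ℝ) : coordGradient (fun y => A y - B y) x = coordGradient A x - coordGradient B x := by
  funext i
  simp only [coordGradient, Pi.sub_apply]
  rw [fderiv_fun_sub (hA x) (hB x), _root_.sub_apply]

open Classical in
/-- **Gradient of a composition with the block projection**: `∂_i(Φ ∘ P_s)(y) = 1_{i ∈ s} ∂_iΦ(P_s y)`.
[cite: Spivak1965, Thm 2-2 (chain rule), Thm 2-3 (1)–(2); FriedliVelenik2017, Lemma 6.3] -/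
theorem coordGradient_comp_cproj (s : Set (Fin n)) {Φ : (Fin n → ℝ) → ℝ} (hΦ : Differentiable ℝ Φ)
    (y : Fin n → ℝ) (i : Fin n) :
    coordGradient (fun y' => Φ (cproj s y')) y i = if i ∈ s then coordGradient Φ (cproj s y) i else 0 := by
  have h : HasFDerivAt (fun y' => Φ (cproj s y')) ((fderiv ℝ Φ (cproj s y)).comp (cproj s)) y :=
    (hΦ (cproj s y)).hasFDerivAt.comp y (cproj s).hasFDerivAt
  simp only [coordGradient]
  rw [h.fderiv, ContinuousLinearMap.comp_apply]
  by_cases hi : i ∈ s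
  · rw [if_pos hi, cproj_single_of_mem hi]
  · rw [if_neg hi, cproj_single_of_not_mem hi, map_zero]

/-- `Φ ∘ P_s` is a function of the `s`-coordinates. [cite: FriedliVelenik2017, Lemma 6.3] -/
theorem dependsOn_comp_cproj_self (s : Set (Fin n)) {G : Type*} (Φ : (Fin n → ℝ) → G) :
    DependsOn (fun y => Φ (cproj s y)) s := by
  intro y y' h
  show Φ (cproj s y) = Φ (cproj s y')
  rw [cproj_eq_of_agree h]

/-- Precomposition with `P_s` preserves `t`-dependence. [cite: FriedliVelenik2017, Lemma 6.3] -/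
theorem dependsOn_comp_cproj {s t : Set (Fin n)} {G : Type*} {Φ : (Fin n → ℝ) → G} (hΦ : DependsOn Φ t) :
    DependsOn (fun y => Φ (cproj s y)) t := by
  intro y y' h
  refine hΦ fun i hi => ?_
  by_cases his : i ∈ s
  · rw [cproj_apply_of_mem his, cproj_apply_of_mem his, h i hi]
  · rw [cproj_apply_of_not_mem his, cproj_apply_of_not_mem his]

/-- Precomposition with `merge lab x ·` preserves `t`-dependence (in `z`).
[cite: FriedliVelenik2017, Lemma 6.3; FriedliVelenik2017, Lemma 6.7 (6.7)–(6.10)] -/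
theorem dependsOn_comp_merge_right (lab : Fin n → Fin 3) (x : Fin n → ℝ) {t : Set (Fin n)} {G : Type*}
    {Φ : (Fin n → ℝ) → G} (hΦ : DependsOn Φ t) : DependsOn (fun z => Φ (merge lab x z)) t := by
  intro z z' h
  refine hΦ fun i hi => ?_
  by_cases h1 : lab i = 1
  · rw [merge_apply_shell h1, merge_apply_shell h1]
  · rw [merge_apply_of_ne h1, merge_apply_of_ne h1, h i hi]

/-- A `t`-measurable function does not see the projection `P_s` when `t ⊆ s`. [cite: FriedliVelenik2017, Lemma 6.3] -/
theorem apply_cproj_eq_of_dependsOn {s t : Set (Fin n)} {G : Type*} {Φ : (Fin n → ℝ) → G} (hΦ : DependsOn Φ t)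
    (hts : t ⊆ s) (y : Fin n → ℝ) : Φ (cproj s y) = Φ y :=
  hΦ fun _ hi => cproj_apply_of_mem (hts hi) y

/-- `t`-dependence is preserved by scalar multiplication. [cite: FriedliVelenik2017, Lemma 6.3] -/
theorem dependsOn_const_mul {t : Set (Fin n)} {Φ : (Fin n → ℝ) → ℝ} (hΦ : DependsOn Φ t) (c : ℝ) :
    DependsOn (fun y => c * Φ y) t := by
  intro y y' h
  show c * Φ y = c * Φ y'
  rw [hΦ h]

/-- `|u − v|² ≤ 2|u|² + 2|v|²`. [folklore] -/
private theorem dotProduct_self_sub_le (u v : Fin n → ℝ) :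
    (u - v) ⬝ᵥ (u - v) ≤ 2 * (u ⬝ᵥ u) + 2 * (v ⬝ᵥ v) := by
  simp only [dotProduct, Pi.sub_apply, Finset.mul_sum, ← Finset.sum_add_distrib]
  exact Finset.sum_le_sum fun i _ => by nlinarith [sq_nonneg (u i + v i)]

/-- A vector whose entries are entries of `w` or `0` is not longer than `w`. [folklore] -/
private theorem dotProduct_self_le_of_eq_or_zero (v w : Fin n → ℝ) (h : ∀ i, v i = w i ∨ v i = 0) :
    v ⬝ᵥ v ≤ w ⬝ᵥ w :=
  Finset.sum_le_sum fun i _ => by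
    rcases h i with h | h
    · rw [h]
    · rw [h, mul_zero]; exact mul_self_nonneg _

/-- `f ∈ C²` ⇒ every partial derivative `∂_j f ∈ C¹`. [cite: Spivak1965, Thm 2-7, Thm 2-8] -/
theorem contDiff_one_coordGradient {f : (Fin n → ℝ) → ℝ} (hf : ContDiff ℝ 2 f) (j : Fin n) :
    ContDiff ℝ 1 (fun y => coordGradient f y j) := by
  have h : ContDiff ℝ 1 (fderiv ℝ f) := hf.fderiv_right (m := 1) (by norm_num)
  exact h.clm_apply contDiff_const

/-- Gradient of a coordinate multiple: `∇(λ·z_k) = λ e_k`. [cite: Spivak1965, Thm 2-3] -/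
theorem coordGradient_const_mul_apply (lam : ℝ) (k : Fin n) (z : Fin n → ℝ) (i : Fin n) :
    coordGradient (fun z : Fin n → ℝ => lam * z k) z i = if i = k then lam else 0 := by
  have h : HasFDerivAt (fun z : Fin n → ℝ => lam * z k)
      (lam • (ContinuousLinearMap.proj k : (Fin n → ℝ) →L[ℝ] ℝ)) z :=
    ((ContinuousLinearMap.proj k : (Fin n → ℝ) →L[ℝ] ℝ).hasFDerivAt).const_smul lam
  simp only [coordGradient]
  rw [h.fderiv, FunLike.coe_smul, Pi.smul_apply, ContinuousLinearMap.proj_apply, smul_eq_mul]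
  by_cases hi : i = k
  · subst hi; simp
  · rw [if_neg hi, Pi.single_eq_of_ne (fun h => hi h.symm), mul_zero]

/-- `|∇(λ·z_k)|² = λ²`. [cite: Spivak1965, Thm 2-3] -/
theorem gradSq_const_mul_apply (lam : ℝ) (k : Fin n) (z : Fin n → ℝ) :
    coordGradient (fun z : Fin n → ℝ => lam * z k) z ⬝ᵥ coordGradient (fun z : Fin n → ℝ => lam * z k) z
      = lam ^ 2 := by
  have e : coordGradient (fun z : Fin n → ℝ => lam * z k) z = fun i => if i = k then lam else 0 :=
    funext fun i => coordGradient_const_mul_apply lam k z i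
  rw [e]
  simp only [dotProduct, mul_ite, ite_mul, mul_zero, zero_mul]
  rw [Finset.sum_ite_eq' Finset.univ k]
  simp [sq]

/-- `z ↦ λ z_k` is differentiable. [folklore] -/
private theorem differentiable_const_mul_apply (lam : ℝ) (k : Fin n) :
    Differentiable ℝ (fun z : Fin n → ℝ => lam * z k) :=
  (differentiable_apply k).const_mul lam

/-- `z ↦ λ z_k` is smooth. [folklore] -/
private theorem contDiff_const_mul_apply (lam : ℝ) (k : Fin n) {m : WithTop ℕ∞} :
    ContDiff ℝ m (fun z : Fin n → ℝ => lam * z k) :=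
  contDiff_const.mul (contDiff_apply ℝ ℝ k)

/-- **The gradient of the regularised conditional potential**:
`∂_k g_x(z) = 1_{lab k ≠ 1} ∂_k f₁(merge lab x z) + 1_{lab k ≠ 0} λ z_k`.
[cite: Spivak1965, Thm 2-2 (chain rule), Thm 2-3 (1)–(2); FriedliVelenik2017, Lemma 6.7 (6.7); FriedliVelenik2017, §6.10.1 (6.110)] -/
theorem coordGradient_condPot (lab : Fin n → Fin 3) (lam : ℝ) {f₁ : (Fin n → ℝ) → ℝ}
    (hf₁ : Differentiable ℝ f₁) (x z : Fin n → ℝ) (k : Fin n) :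
    coordGradient (condPot lab lam f₁ x) z k
      = (if lab k ≠ 1 then coordGradient f₁ (merge lab x z) k else 0) + (if lab k ≠ 0 then lam * z k else 0) := by
  have hm : Differentiable ℝ (merge lab x) := (contDiff_merge_right lab x (m := 1)).differentiable one_ne_zero
  have hA : DifferentiableAt ℝ (fun z' => f₁ (merge lab x z')) z := (hf₁.comp hm) z
  have hB : DifferentiableAt ℝ
      (fun z' : Fin n → ℝ => lam / 2 * ∑ j ∈ Finset.univ.filter (fun j => lab j ≠ 0), z' j ^ 2) z :=
    ((contDiff_quadReg lam _ (m := 1)).differentiable one_ne_zero) z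
  have hg := coordGradient_comp_merge_right lab hf₁ x z k
  simp only [coordGradient] at hg ⊢
  unfold condPot
  rw [fderiv_fun_add hA hB, _root_.add_apply, hg, fderiv_quadReg_apply]
  congr 1
  have e : ∀ j : Fin n, z j * (Pi.single k (1 : ℝ) : Fin n → ℝ) j = if j = k then z k else 0 := by
    intro j
    by_cases hj : j = k
    · subst hj; simp
    · rw [Pi.single_eq_of_ne hj, mul_zero, if_neg hj]
  simp_rw [e]
  rw [Finset.sum_ite_eq' _ k]
  simp only [Finset.mem_filter, Finset.mem_univ, true_and, mul_ite, mul_zero]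

end Helpers

/-! ## §1 The local spec `𝔖`, the class `𝔐 = 𝔖.InClass`, admissible triples and the covariance profile `κ` -/

/-- A LOCAL SPEC on `n` real coordinates: a pseudo-metric `d` (integer valued; think of the graph distance of
the lattice sites carrying the coordinates), the interaction RANGE `r`, the window half-width `S > 0`, the uniform
convexity constant `λ > 0`, a Hessian-row constant `R ≥ λ`, and a support budget `a` dominating the volume of
every `r`-ball.  No instance, no notation: plain data + hypotheses.
[folklore] [cite: Martinelli1999, §2.4 p.103 (Def. 2.6); Martinelli1999, §2.1 p.98; FriedliVelenik2017, Def. 6.14 (6.24)] -/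
structure Spec (n : ℕ) where
  /-- pseudo-metric on the coordinates -/
  d : Fin n → Fin n → ℕ
  /-- range of the interaction -/
  r : ℕ
  /-- window half-width -/
  S : ℝ
  /-- uniform convexity constant -/
  lam : ℝ
  /-- Hessian-row bound -/
  R : ℝ
  /-- support budget of the inserts -/
  a : ℕ
  d_self : ∀ i, d i i = 0
  d_comm : ∀ i k, d i k = d k i
  d_tri : ∀ i j k, d i k ≤ d i j + d j k
  S_pos : 0 < S
  lam_pos : 0 < lam
  lam_le : lam ≤ R
  growth_le : ∀ k, (Finset.univ.filter fun i => d i k ≤ r).card ≤ a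

namespace Spec

variable (𝔖 : Spec n)

/-- The `t`-ball `B_t(k) = {i : d(i,k) ≤ t}` of the coordinate `k`. [folklore] [cite: Martinelli1999, §2.1 p.98] -/
def ball (t : ℕ) (k : Fin n) : Finset (Fin n) := Finset.univ.filter fun i => 𝔖.d i k ≤ t

/-- The volume growth function `G(t) = sup_k #B_t(k)`. [folklore] [cite: Martinelli1999, §2.1 p.98] -/
def growth (t : ℕ) : ℕ := Finset.univ.sup fun k => (𝔖.ball t k).card

/-- Membership in a `d`-ball. [cite: Martinelli1999, §2.1 p.98] -/
theorem mem_ball {t : ℕ} {k i : Fin n} : i ∈ 𝔖.ball t k ↔ 𝔖.d i k ≤ t := by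
  simp [ball]

/-- Every coordinate is in its own balls. [cite: Martinelli1999, §2.1 p.98] -/
theorem self_mem_ball (t : ℕ) (k : Fin n) : k ∈ 𝔖.ball t k := by
  rw [mem_ball, 𝔖.d_self]; exact Nat.zero_le _

/-- A ball is no larger than the volume growth at its radius. [cite: Martinelli1999, §2.1 p.98] -/
theorem card_ball_le_growth (t : ℕ) (k : Fin n) : (𝔖.ball t k).card ≤ 𝔖.growth t :=
  Finset.le_sup (f := fun k => (𝔖.ball t k).card) (Finset.mem_univ k)

/-- A range-`r` ball fits in the support budget `a`. [cite: Martinelli1999, §2.1 p.98] -/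
theorem card_ball_le_a (k : Fin n) : (𝔖.ball 𝔖.r k).card ≤ 𝔖.a := 𝔖.growth_le k

/-- `0 < R` (from `0 < λ ≤ R`). [cite: Martinelli1999, §2.1 p.98] -/
theorem R_pos : 0 < 𝔖.R := lt_of_lt_of_le 𝔖.lam_pos 𝔖.lam_le

/-- THE CLASS `𝔐`: `C²`, uniformly `λ`-convex, finite range `r` (each partial derivative `∂_k f` is a function of
the coordinates in `B_r(k)`), Hessian rows bounded by `R`.
[folklore] [cite: BrascampLieb1976, Thm 4.1; FriedliVelenik2017, Def. 6.14 (6.24); HelfferSjostrand1994; Ledoux2001, Prop. 6.2 p.190] -/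
def InClass (f : (Fin n → ℝ) → ℝ) : Prop :=
  ContDiff ℝ 2 f ∧ HessianBound f 𝔖.lam ∧
    (∀ k, DependsOn (fun y => coordGradient f y k) (↑(𝔖.ball 𝔖.r k) : Set (Fin n))) ∧
    ∀ k y, coordGradient (fun y => coordGradient f y k) y ⬝ᵥ coordGradient (fun y => coordGradient f y k) y
      ≤ 𝔖.R ^ 2

/-- An admissible INSERT supported in `A`: `C¹`, `|∇F| ≤ 1`, a function of the coordinates in `A`, `#A ≤ a`.
[folklore] [cite: Martinelli1999, §2.4 p.103 (Def. 2.6)] -/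
def Obs (F : (Fin n → ℝ) → ℝ) (A : Finset (Fin n)) : Prop :=
  ContDiff ℝ 1 F ∧ (∀ y, coordGradient F y ⬝ᵥ coordGradient F y ≤ 1) ∧ DependsOn F (↑A : Set (Fin n)) ∧
    A.card ≤ 𝔖.a

/-- An admissible triple AT SEPARATION `m`: `f ∈ 𝔐` and two inserts whose supports are `> m` apart.
[folklore] [cite: Martinelli1999, §2.4 p.103 (Def. 2.6)] -/
def Adm (m : ℕ) (f F H : (Fin n → ℝ) → ℝ) : Prop :=
  𝔖.InClass f ∧ ∃ A B : Finset (Fin n), 𝔖.Obs F A ∧ 𝔖.Obs H B ∧ ∀ i ∈ A, ∀ k ∈ B, m < 𝔖.d i k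

/-- The set of covariance values realised at separation `m` (with `0` adjoined).
[folklore] [cite: Martinelli1999, §2.4 p.103 (Def. 2.6)] -/
def profileSet (m : ℕ) : Set ℝ :=
  {t | t = 0 ∨ ∃ f F H : (Fin n → ℝ) → ℝ, 𝔖.Adm m f F H ∧ t = |cubeCov f 𝔖.S F H|}

/-- THE COVARIANCE PROFILE `κ(m) = sup {|Cov_K(F,H)| : (f, F, H) admissible at separation m}`.
[folklore] [cite: Martinelli1999, §2.4 p.103 (Def. 2.6)] -/
noncomputable def kappa (m : ℕ) : ℝ := sSup (𝔖.profileSet m)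

/-- `0` is adjoined to the profile set. [cite: Martinelli1999, §2.4 p.103 (Def. 2.6)] -/
theorem zero_mem_profileSet (m : ℕ) : (0 : ℝ) ∈ 𝔖.profileSet m := Or.inl rfl

/-- The profile set is nonempty. [cite: Martinelli1999, §2.4 p.103 (Def. 2.6)] -/
theorem profileSet_nonempty (m : ℕ) : (𝔖.profileSet m).Nonempty := ⟨0, 𝔖.zero_mem_profileSet m⟩

/-- Brascamp–Lieb (tree `abs_cubeCov_le`, by name) bounds every admissible covariance by `λ⁻¹`.
[cite: BrascampLieb1976, Thm 4.1] -/
theorem abs_cubeCov_le_inv_lam {m : ℕ} {f F H : (Fin n → ℝ) → ℝ} (h : 𝔖.Adm m f F H) :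
    |cubeCov f 𝔖.S F H| ≤ 𝔖.lam⁻¹ := by
  obtain ⟨⟨hf, hB, -, -⟩, A, B, ⟨hF, hF1, -, -⟩, ⟨hH, hH1, -, -⟩, -⟩ := h
  have key := abs_cubeCov_le 𝔖.S_pos 𝔖.lam_pos hf hB hF hH one_pos one_pos
    (fun y _ => by rw [one_pow]; exact hF1 y) (fun y _ => by rw [one_pow]; exact hH1 y)
  simpa using key

/-- The profile set is bounded above by `λ⁻¹` (Brascamp–Lieb). [cite: BrascampLieb1976, Thm 4.1] -/
theorem profileSet_bddAbove (m : ℕ) : BddAbove (𝔖.profileSet m) := by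
  refine ⟨𝔖.lam⁻¹, ?_⟩
  rintro t (rfl | ⟨f, F, H, hA, rfl⟩)
  · exact inv_nonneg.mpr 𝔖.lam_pos.le
  · exact 𝔖.abs_cubeCov_le_inv_lam hA

/-- The profile set consists of non-negative reals. [cite: Martinelli1999, §2.4 p.103 (Def. 2.6)] -/
theorem profileSet_nonneg (m : ℕ) : ∀ t ∈ 𝔖.profileSet m, 0 ≤ t := by
  rintro t (rfl | ⟨f, F, H, -, rfl⟩)
  · exact le_rfl
  · exact abs_nonneg _

/-- `0 ≤ κ(m)`. [cite: Martinelli1999, §2.4 p.103 (Def. 2.6)] -/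
theorem kappa_nonneg (m : ℕ) : 0 ≤ 𝔖.kappa m :=
  le_csSup (𝔖.profileSet_bddAbove m) (𝔖.zero_mem_profileSet m)

/-- **Every admissible covariance is bounded by the profile.** [cite: Martinelli1999, §2.4 p.103 (Def. 2.6)] -/
theorem abs_cubeCov_le_kappa {m : ℕ} {f F H : (Fin n → ℝ) → ℝ} (h : 𝔖.Adm m f F H) :
    |cubeCov f 𝔖.S F H| ≤ 𝔖.kappa m :=
  le_csSup (𝔖.profileSet_bddAbove m) (Or.inr ⟨f, F, H, h, rfl⟩)

/-- **The profile is the LEAST such bound.** [cite: Martinelli1999, §2.4 p.103 (Def. 2.6)] -/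
theorem kappa_le_of_forall {m : ℕ} {b : ℝ} (hb : 0 ≤ b)
    (h : ∀ f F H : (Fin n → ℝ) → ℝ, 𝔖.Adm m f F H → |cubeCov f 𝔖.S F H| ≤ b) : 𝔖.kappa m ≤ b := by
  refine csSup_le (𝔖.profileSet_nonempty m) ?_
  rintro t (rfl | ⟨f, F, H, hA, rfl⟩)
  · exact hb
  · exact h f F H hA

/-- `κ(m) ≤ λ⁻¹` (Brascamp–Lieb; the level-0 bound, no decay). [cite: BrascampLieb1976, Thm 4.1] -/
theorem kappa_le_inv_lam (m : ℕ) : 𝔖.kappa m ≤ 𝔖.lam⁻¹ :=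
  𝔖.kappa_le_of_forall (inv_nonneg.mpr 𝔖.lam_pos.le) fun _ _ _ h => 𝔖.abs_cubeCov_le_inv_lam h

/-- Admissibility is monotone in the separation: `Adm m' ⊆ Adm m` for `m ≤ m'`. [cite: Martinelli1999, §2.4 p.103 (Def. 2.6)] -/
theorem Adm.anti {m m' : ℕ} (hmm' : m ≤ m') {f F H : (Fin n → ℝ) → ℝ} (h : 𝔖.Adm m' f F H) :
    𝔖.Adm m f F H := by
  obtain ⟨hf, A, B, hF, hH, hsep⟩ := h
  exact ⟨hf, A, B, hF, hH, fun i hi k hk => lt_of_le_of_lt hmm' (hsep i hi k hk)⟩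

/-- **The profile is non-increasing in the separation.** [cite: Martinelli1999, §2.4 p.103 (Def. 2.6)] -/
theorem kappa_antitone : Antitone 𝔖.kappa := fun m _ hmm' =>
  𝔖.kappa_le_of_forall (𝔖.kappa_nonneg m) fun _ _ _ h => 𝔖.abs_cubeCov_le_kappa (Adm.anti 𝔖 hmm' h)

end Spec

/-! ## §2 The canonical split `f = f₁ + f₂` along a labelling, one-sided recursion data, and CLOSURE:
the regularised conditional potential is again in `𝔐` and the recursion inserts are admissible at level `m` -/

section Split

variable (𝔖 : Spec n)

/-- The inside-blind part `f₂ = f ∘ P_{lab ≠ 0}` of a potential along a labelling.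
[folklore] [cite: FriedliVelenik2017, Lemma 6.3; FriedliVelenik2017, Lemma 6.7 (6.7)–(6.10)] -/
noncomputable def fHi (lab : Fin n → Fin 3) (f : (Fin n → ℝ) → ℝ) : (Fin n → ℝ) → ℝ :=
  fun y => f (cproj {i | lab i ≠ 0} y)

/-- The remainder `f₁ = f − f ∘ P_{lab ≠ 0}`.
[folklore] [cite: FriedliVelenik2017, Lemma 6.3; FriedliVelenik2017, Lemma 6.7 (6.7)–(6.10)] -/
noncomputable def fLo (lab : Fin n → Fin 3) (f : (Fin n → ℝ) → ℝ) : (Fin n → ℝ) → ℝ :=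
  fun y => f y - fHi lab f y

/-- The canonical split recomposes: `fLo + fHi = f`. [cite: FriedliVelenik2017, Lemma 6.7 (6.7)–(6.10)] -/
theorem fLo_add_fHi (lab : Fin n → Fin 3) (f : (Fin n → ℝ) → ℝ) : fLo lab f + fHi lab f = f := by
  funext y; simp [fLo]

/-- `fHi` inherits the smoothness of `f`. [cite: Spivak1965, Thm 2-2 (chain rule), Thm 2-3 (1)–(2)] -/
theorem contDiff_fHi (lab : Fin n → Fin 3) {f : (Fin n → ℝ) → ℝ} {m : WithTop ℕ∞} (hf : ContDiff ℝ m f) :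
    ContDiff ℝ m (fHi lab f) := by
  have h : ContDiff ℝ m (fun y : Fin n → ℝ => cproj {i | lab i ≠ 0} y) := (cproj {i | lab i ≠ 0}).contDiff
  exact hf.comp h

/-- `fLo` inherits the smoothness of `f`. [cite: Spivak1965, Thm 2-2 (chain rule), Thm 2-3 (1)–(2)] -/
theorem contDiff_fLo (lab : Fin n → Fin 3) {f : (Fin n → ℝ) → ℝ} {m : WithTop ℕ∞} (hf : ContDiff ℝ m f) :
    ContDiff ℝ m (fLo lab f) :=
  hf.sub (contDiff_fHi lab hf)

/-- `fHi` is a function of the coordinates off the inside block. [cite: FriedliVelenik2017, Lemma 6.3] -/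
theorem fHi_dependsOn (lab : Fin n → Fin 3) (f : (Fin n → ℝ) → ℝ) : DependsOn (fHi lab f) {i | lab i ≠ 0} :=
  dependsOn_comp_cproj_self _ f

/-- Partials of `fHi`: those of `f` at the projected point off the inside block, `0` on it. [cite: Spivak1965, Thm 2-2 (chain rule), Thm 2-3 (1)–(2); FriedliVelenik2017, Lemma 6.3] -/
theorem coordGradient_fHi (lab : Fin n → Fin 3) {f : (Fin n → ℝ) → ℝ} (hf : Differentiable ℝ f)
    (y : Fin n → ℝ) (k : Fin n) :
    coordGradient (fHi lab f) y k = if lab k ≠ 0 then coordGradient f (cproj {i | lab i ≠ 0} y) k else 0 := by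
  have h := coordGradient_comp_cproj {i | lab i ≠ 0} hf y k
  rw [show fHi lab f = fun y' => f (cproj {i | lab i ≠ 0} y') from rfl, h]
  by_cases hk : lab k ≠ 0
  · rw [if_pos hk, if_pos (show k ∈ {i | lab i ≠ 0} from hk)]
  · rw [if_neg hk, if_neg (show k ∉ {i | lab i ≠ 0} from hk)]

/-- Partials of `fLo = f − fHi`. [cite: Spivak1965, Thm 2-3] -/
theorem coordGradient_fLo (lab : Fin n → Fin 3) {f : (Fin n → ℝ) → ℝ} (hf : Differentiable ℝ f)
    (y : Fin n → ℝ) (k : Fin n) :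
    coordGradient (fLo lab f) y k = coordGradient f y k - coordGradient (fHi lab f) y k := by
  have hdHi : Differentiable ℝ (fHi lab f) := hf.comp (cproj _).differentiable
  rw [show fLo lab f = fun y' => f y' - fHi lab f y' from rfl, coordGradient_sub hf hdHi y, Pi.sub_apply]

/-- The 0 ↔ 2 SWAPPED labelling (same shell). [folklore] [cite: FriedliVelenik2017, Lemma 6.7 (6.7)–(6.10)] -/
def lswap (lab : Fin n → Fin 3) : Fin n → Fin 3 :=
  fun i => if lab i = 0 then 2 else if lab i = 2 then 0 else 1

/-- The swapped labelling exchanges inside and outside and keeps the shell. [cite: FriedliVelenik2017, Lemma 6.7 (6.7)–(6.10)] -/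
theorem lswap_spec (lab : Fin n → Fin 3) (i : Fin n) :
    (lswap lab i = 0 ↔ lab i = 2) ∧ (lswap lab i = 1 ↔ lab i = 1) ∧ (lswap lab i = 2 ↔ lab i = 0) := by
  have key : ∀ c : Fin 3, ((if c = 0 then (2 : Fin 3) else if c = 2 then 0 else 1) = 0 ↔ c = 2) ∧
      ((if c = 0 then (2 : Fin 3) else if c = 2 then 0 else 1) = 1 ↔ c = 1) ∧
      ((if c = 0 then (2 : Fin 3) else if c = 2 then 0 else 1) = 2 ↔ c = 0) := by decide
  exact key (lab i)

/-- `merge` only sees the shell, so it is unchanged under the swap. [cite: FriedliVelenik2017, Lemma 6.7 (6.7)–(6.10)] -/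
theorem merge_lswap (lab : Fin n → Fin 3) (x z : Fin n → ℝ) : merge (lswap lab) x z = merge lab x z := by
  funext i
  by_cases h1 : lab i = 1
  · rw [merge_apply_shell h1, merge_apply_shell ((lswap_spec lab i).2.1.mpr h1)]
  · rw [merge_apply_of_ne h1, merge_apply_of_ne (fun h => h1 ((lswap_spec lab i).2.1.mp h))]

/-- The shell-conditional covariance is unchanged under the swap of inside and outside. [cite: FriedliVelenik2017, Lemma 6.7 (6.7)–(6.10); FriedliVelenik2017, Lemma 6.7 (6.7); FriedliVelenik2017, §6.10.1 (6.110)] -/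
theorem shellCov_lswap (lab : Fin n → Fin 3) (f : (Fin n → ℝ) → ℝ) (S : ℝ) (F G : (Fin n → ℝ) → ℝ)
    (x : Fin n → ℝ) : shellCov (lswap lab) f S F G x = shellCov lab f S F G x := by
  simp only [shellCov, shellMean, shellMass, merge_lswap]

namespace Spec

/-- The WIDTH condition of a labelling: inside and outside are more than the range `r` apart.
[folklore] [cite: FriedliVelenik2017, Lemma 6.7 (6.7)–(6.10); Martinelli1999, §2.1 p.98] -/
def Wide (lab : Fin n → Fin 3) : Prop := ∀ i k, lab i = 0 → lab k = 2 → 𝔖.r < 𝔖.d i k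

/-- Under a wide labelling the range-ball of an outside coordinate misses the inside block. [cite: Martinelli1999, §2.1 p.98] -/
theorem ball_subset_of_two {lab : Fin n → Fin 3} (hw : 𝔖.Wide lab) {k : Fin n} (hk : lab k = 2) :
    (↑(𝔖.ball 𝔖.r k) : Set (Fin n)) ⊆ {i | lab i ≠ 0} := by
  intro i hi h0
  have hi' : 𝔖.d i k ≤ 𝔖.r := 𝔖.mem_ball.mp (Finset.mem_coe.mp hi)
  exact absurd (hw i k h0 hk) (not_lt.mpr hi')

/-- Under a wide labelling the range-ball of an inside coordinate misses the outside block. [cite: Martinelli1999, §2.1 p.98] -/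
theorem ball_subset_of_zero {lab : Fin n → Fin 3} (hw : 𝔖.Wide lab) {k : Fin n} (hk : lab k = 0) :
    (↑(𝔖.ball 𝔖.r k) : Set (Fin n)) ⊆ {i | lab i ≠ 2} := by
  intro i hi h2
  have hi' : 𝔖.d i k ≤ 𝔖.r := 𝔖.mem_ball.mp (Finset.mem_coe.mp hi)
  have h := hw k i hk h2
  rw [𝔖.d_comm] at h
  exact absurd h (not_lt.mpr hi')

/-- Wideness is symmetric under the swap. [cite: Martinelli1999, §2.1 p.98] -/
theorem wide_lswap {lab : Fin n → Fin 3} (hw : 𝔖.Wide lab) : 𝔖.Wide (lswap lab) := by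
  intro i k hi hk
  rw [𝔖.d_comm]
  exact hw k i ((lswap_spec lab k).2.2.mp hk) ((lswap_spec lab i).1.mp hi)

/-- ONE-SIDED RECURSION DATA along a labelling `lab`: the potential `f ∈ 𝔐` split as `f = f₁ + f₂` with `f₁`
outside-blind and `f₂` inside-blind, `∂_k f₁ = ∂_k f` on inside coordinates, finite-range shell partials of `f₁`
with Hessian rows `≤ C`, and the width condition.  (A `Prop`-valued record; no instance.)
[folklore] [cite: FriedliVelenik2017, Lemma 6.7 (6.7); FriedliVelenik2017, §6.10.1 (6.110); BrascampLieb1976, Thm 4.1; FriedliVelenik2017, Exercise 3.11 (3.26); GlimmJaffe1987, Cor. 4.3.4 (proof)] -/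
structure SideData (lab : Fin n → Fin 3) (f f₁ f₂ : (Fin n → ℝ) → ℝ) (C : ℝ) : Prop where
  inClass : 𝔖.InClass f
  add_eq : f₁ + f₂ = f
  cd₁ : ContDiff ℝ 2 f₁
  cd₂ : ContDiff ℝ 2 f₂
  dep₁ : DependsOn f₁ {i | lab i ≠ 2}
  dep₂ : DependsOn f₂ {i | lab i ≠ 0}
  inside : ∀ k, lab k = 0 → ∀ y, coordGradient f₁ y k = coordGradient f y k
  shell_dep : ∀ j, lab j = 1 → DependsOn (fun y => coordGradient f₁ y j) (↑(𝔖.ball 𝔖.r j) : Set (Fin n))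
  shell_row : ∀ j, lab j = 1 → ∀ y,
    coordGradient (fun y => coordGradient f₁ y j) y ⬝ᵥ coordGradient (fun y => coordGradient f₁ y j) y ≤ C ^ 2
  C_pos : 0 < C
  wide : 𝔖.Wide lab

/-- **The canonical split supplies the F-side data** (row constant `2R`: `∂_j f₁ = ∂_j f − (∂_j f) ∘ P` on the shell).
[cite: FriedliVelenik2017, Lemma 6.7 (6.7)–(6.10); Spivak1965, Thm 2-7; FriedliVelenik2017, Lemma 6.3] -/
theorem sideData_lo {lab : Fin n → Fin 3} {f : (Fin n → ℝ) → ℝ} (hf : 𝔖.InClass f) (hw : 𝔖.Wide lab) :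
    𝔖.SideData lab f (fLo lab f) (fHi lab f) (2 * 𝔖.R) := by
  obtain ⟨hfc, hB, hloc, hrow⟩ := hf
  have hd : Differentiable ℝ f := hfc.differentiable (by norm_num)
  have hdHi : Differentiable ℝ (fHi lab f) := hd.comp (cproj _).differentiable
  have hdk : ∀ k, Differentiable ℝ (fun y => coordGradient f y k) := fun k =>
    (contDiff_one_coordGradient hfc k).differentiable one_ne_zero
  have gHi := coordGradient_fHi lab hd
  have gLo := coordGradient_fLo lab hd
  have eshell : ∀ j, lab j = 1 → (fun y => coordGradient (fLo lab f) y j)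
      = fun y => coordGradient f y j - coordGradient f (cproj {i | lab i ≠ 0} y) j := by
    intro j hj
    funext y
    rw [gLo, gHi, if_pos (by rw [hj]; decide)]
  refine
    { inClass := ⟨hfc, hB, hloc, hrow⟩
      add_eq := fLo_add_fHi lab f
      cd₁ := contDiff_fLo lab hfc
      cd₂ := contDiff_fHi lab hfc
      dep₁ := ?_
      dep₂ := fHi_dependsOn lab f
      inside := ?_
      shell_dep := ?_
      shell_row := ?_
      C_pos := by have := 𝔖.R_pos; positivity
      wide := hw }
  · have hdLo : Differentiable ℝ (fLo lab f) := (contDiff_fLo lab hfc).differentiable (by norm_num)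
    refine dependsOn_of_coordGradient_eq_zero (g := fLo lab f) hdLo fun k hk y => ?_
    have hk2 : lab k = 2 := by
      have : ¬ (lab k ≠ 2) := hk
      exact not_not.mp this
    rw [gLo, gHi, if_pos (by rw [hk2]; decide),
      apply_cproj_eq_of_dependsOn (hloc k) (𝔖.ball_subset_of_two hw hk2) y, sub_self]
  · intro k hk y
    rw [gLo, gHi, if_neg (by rw [hk]; decide), sub_zero]
  · intro j hj
    rw [eshell j hj]
    intro y y' h
    show coordGradient f y j - coordGradient f (cproj {i | lab i ≠ 0} y) j
      = coordGradient f y' j - coordGradient f (cproj {i | lab i ≠ 0} y') j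
    have e1 : coordGradient f y j = coordGradient f y' j := hloc j h
    have e2 : coordGradient f (cproj {i | lab i ≠ 0} y) j = coordGradient f (cproj {i | lab i ≠ 0} y') j :=
      dependsOn_comp_cproj (s := {i | lab i ≠ 0}) (hloc j) h
    rw [e1, e2]
  · intro j hj y
    have hdv : Differentiable ℝ (fun y => coordGradient f (cproj {i | lab i ≠ 0} y) j) :=
      (hdk j).comp (cproj _).differentiable
    rw [eshell j hj, coordGradient_sub (hdk j) hdv y]
    refine (dotProduct_self_sub_le _ _).trans ?_
    have hv : coordGradient (fun y' => coordGradient f (cproj {i | lab i ≠ 0} y') j) y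
        ⬝ᵥ coordGradient (fun y' => coordGradient f (cproj {i | lab i ≠ 0} y') j) y ≤ 𝔖.R ^ 2 :=
      (dotProduct_self_le_of_eq_or_zero _
          (coordGradient (fun y => coordGradient f y j) (cproj {i | lab i ≠ 0} y)) fun i => by
        rw [coordGradient_comp_cproj {i | lab i ≠ 0} (hdk j) y i]
        split_ifs
        · exact Or.inl rfl
        · exact Or.inr rfl).trans (hrow j _)
    have hu := hrow j y
    nlinarith

/-- **… and the H-side data for the swapped labelling** (row constant `R`: `∂_j f₂ = (∂_j f) ∘ P` on the shell).
[cite: FriedliVelenik2017, Lemma 6.7 (6.7)–(6.10); Spivak1965, Thm 2-7; FriedliVelenik2017, Lemma 6.3] -/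
theorem sideData_hi {lab : Fin n → Fin 3} {f : (Fin n → ℝ) → ℝ} (hf : 𝔖.InClass f) (hw : 𝔖.Wide lab) :
    𝔖.SideData (lswap lab) f (fHi lab f) (fLo lab f) 𝔖.R := by
  have hlo := 𝔖.sideData_lo hf hw
  obtain ⟨hfc, hB, hloc, hrow⟩ := hf
  have hd : Differentiable ℝ f := hfc.differentiable (by norm_num)
  have hdk : ∀ k, Differentiable ℝ (fun y => coordGradient f y k) := fun k =>
    (contDiff_one_coordGradient hfc k).differentiable one_ne_zero
  have gHi := coordGradient_fHi lab hd
  have eshell : ∀ j, lab j = 1 → (fun y => coordGradient (fHi lab f) y j)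
      = fun y => coordGradient f (cproj {i | lab i ≠ 0} y) j := by
    intro j hj
    funext y
    rw [gHi, if_pos (by rw [hj]; decide)]
  refine
    { inClass := ⟨hfc, hB, hloc, hrow⟩
      add_eq := by rw [add_comm]; exact fLo_add_fHi lab f
      cd₁ := contDiff_fHi lab hfc
      cd₂ := contDiff_fLo lab hfc
      dep₁ := (fHi_dependsOn lab f).mono fun i hi => ?_
      dep₂ := hlo.dep₁.mono fun i hi => ?_
      inside := ?_
      shell_dep := ?_
      shell_row := ?_
      C_pos := 𝔖.R_pos
      wide := 𝔖.wide_lswap hw }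
  · intro h
    exact hi ((lswap_spec lab i).2.2.mp h)
  · intro h
    exact hi ((lswap_spec lab i).1.mp h)
  · intro k hk y
    have hk2 : lab k = 2 := (lswap_spec lab k).1.mp hk
    rw [gHi, if_pos (by rw [hk2]; decide), apply_cproj_eq_of_dependsOn (hloc k) (𝔖.ball_subset_of_two hw hk2) y]
  · intro j hj
    rw [eshell j ((lswap_spec lab j).2.1.mp hj)]
    exact dependsOn_comp_cproj (hloc j)
  · intro j hj y
    have hj1 : lab j = 1 := (lswap_spec lab j).2.1.mp hj
    rw [eshell j hj1]
    exact (dotProduct_self_le_of_eq_or_zero _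
        (coordGradient (fun y => coordGradient f y j) (cproj {i | lab i ≠ 0} y)) fun i => by
      rw [coordGradient_comp_cproj {i | lab i ≠ 0} (hdk j) y i]
      split_ifs
      · exact Or.inl rfl
      · exact Or.inr rfl).trans (hrow j _)

/-- On a non-inside coordinate the gradient of the regularised conditional potential is `λ z_k`.
[cite: Spivak1965, Thm 2-2 (chain rule), Thm 2-3 (1)–(2); FriedliVelenik2017, Lemma 6.7 (6.7); FriedliVelenik2017, §6.10.1 (6.110)] -/
theorem coordGradient_condPot_of_ne_zero (lab : Fin n → Fin 3) (lam : ℝ) {f₁ : (Fin n → ℝ) → ℝ}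
    (hf₁ : Differentiable ℝ f₁) (hdep : DependsOn f₁ {i | lab i ≠ 2}) {k : Fin n} (hk : lab k ≠ 0)
    (x z : Fin n → ℝ) : coordGradient (condPot lab lam f₁ x) z k = lam * z k := by
  rw [coordGradient_condPot lab lam hf₁ x z k, if_pos hk]
  have h0 : (if lab k ≠ 1 then coordGradient f₁ (merge lab x z) k else 0) = 0 := by
    by_cases h1 : lab k = 1
    · rw [if_neg (not_not.mpr h1)]
    · have h2 : lab k = 2 := by
        have key : ∀ c : Fin 3, c ≠ 0 → c ≠ 1 → c = 2 := by decide
        exact key _ hk h1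
      rw [if_pos h1, coordGradient_eq_zero_of_dependsOn hdep (fun h => h h2) (merge lab x z)]
  rw [h0, zero_add]

/-- On an inside coordinate it is `∂_k f₁ (merge lab x z)`.
[cite: Spivak1965, Thm 2-2 (chain rule), Thm 2-3 (1)–(2); FriedliVelenik2017, Lemma 6.7 (6.7); FriedliVelenik2017, §6.10.1 (6.110)] -/
theorem coordGradient_condPot_of_zero (lab : Fin n → Fin 3) (lam : ℝ) {f₁ : (Fin n → ℝ) → ℝ}
    (hf₁ : Differentiable ℝ f₁) {k : Fin n} (hk : lab k = 0) (x z : Fin n → ℝ) :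
    coordGradient (condPot lab lam f₁ x) z k = coordGradient f₁ (merge lab x z) k := by
  rw [coordGradient_condPot lab lam hf₁ x z k, if_pos (by rw [hk]; decide), if_neg (by rw [hk]; decide), add_zero]

/-- **CLOSURE OF THE CLASS UNDER CONDITIONING (PROVED)**: along one-sided recursion data, for every shell
configuration `x` the regularised conditional potential `condPot lab λ f₁ x` is again in `𝔐` — same spec `𝔖`.
[cite: HornJohnson2013, Thm 4.3.28 (4.3.30); BrascampLieb1976, Thm 4.1; FriedliVelenik2017, Lemma 6.7 (6.7); FriedliVelenik2017, §6.10.1 (6.110)] -/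
theorem inClass_condPot {lab : Fin n → Fin 3} {f f₁ f₂ : (Fin n → ℝ) → ℝ} {C : ℝ}
    (hD : 𝔖.SideData lab f f₁ f₂ C) (x : Fin n → ℝ) : 𝔖.InClass (condPot lab 𝔖.lam f₁ x) := by
  obtain ⟨hfc, hB, hloc, hrow⟩ := hD.inClass
  have hd₁ : Differentiable ℝ f₁ := hD.cd₁.differentiable (by norm_num)
  have hdk : ∀ k, Differentiable ℝ (fun y => coordGradient f y k) := fun k =>
    (contDiff_one_coordGradient hfc k).differentiable one_ne_zero
  have hB' : HessianBound (f₁ + f₂) 𝔖.lam := by rw [hD.add_eq]; exact hB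
  have e0 : ∀ k, lab k = 0 → (fun z => coordGradient (condPot lab 𝔖.lam f₁ x) z k)
      = fun z => coordGradient f (merge lab x z) k := by
    intro k hk
    funext z
    rw [coordGradient_condPot_of_zero lab 𝔖.lam hd₁ hk x z, hD.inside k hk]
  have e1 : ∀ k, lab k ≠ 0 → (fun z => coordGradient (condPot lab 𝔖.lam f₁ x) z k)
      = fun z : Fin n → ℝ => 𝔖.lam * z k := by
    intro k hk
    funext z
    exact coordGradient_condPot_of_ne_zero lab 𝔖.lam hd₁ hD.dep₁ hk x z
  refine ⟨contDiff_condPot lab 𝔖.lam hD.cd₁ x, hessianBound_condPot lab hD.cd₁ hD.cd₂ hB' hD.dep₁ hD.dep₂ x,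
    fun k => ?_, fun k z => ?_⟩
  · by_cases hk : lab k = 0
    · rw [e0 k hk]
      exact dependsOn_comp_merge_right lab x (hloc k)
    · rw [e1 k hk]
      intro z z' h
      show 𝔖.lam * z k = 𝔖.lam * z' k
      rw [h k (Finset.mem_coe.mpr (𝔖.self_mem_ball _ k))]
  · by_cases hk : lab k = 0
    · rw [e0 k hk]
      exact (gradSq_comp_merge_le lab (hdk k) x z).trans (hrow k _)
    · rw [e1 k hk, gradSq_const_mul_apply]
      exact pow_le_pow_left₀ 𝔖.lam_pos.le 𝔖.lam_le 2

/-- **THE ONE-SIDED RECURSION BOUND (PROVED)**: along one-sided data with row constant `C`, for an insert `F`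
supported in `A ⊆ inside` with `d(A, shell) > m + r`, EVERY shell-indexed conditional covariance is bounded by
`C · κ(m)` — because the triple (`condPot lab λ f₁ x`, `F ∘ merge`, `C⁻¹·(∂_j f₁) ∘ merge`) is ADMISSIBLE AT LEVEL `m`
for the same spec (`inClass_condPot` + support ∕ separation bookkeeping) and the conditional covariance IS its cube
covariance (G8 `shellCov_grad_eq_cubeCov_condPot`).
[cite: BrascampLieb1976, Thm 4.1; FriedliVelenik2017, Lemma 6.7 (6.7); FriedliVelenik2017, §6.10.1 (6.110); Martinelli1999, §2.4 p.103 (Def. 2.6)] -/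
theorem side_bound {lab : Fin n → Fin 3} {f f₁ f₂ : (Fin n → ℝ) → ℝ} {C : ℝ} (hD : 𝔖.SideData lab f f₁ f₂ C)
    {m : ℕ} {F : (Fin n → ℝ) → ℝ} {A : Finset (Fin n)} (hF : 𝔖.Obs F A) (hA0 : ∀ i ∈ A, lab i = 0)
    (hA1 : ∀ j, lab j = 1 → ∀ i ∈ A, m + 𝔖.r < 𝔖.d i j) :
    ∀ x ∈ cube n 𝔖.S, ∀ j, lab j = 1 →
      |shellCov lab f₁ 𝔖.S F (fun y => coordGradient f₁ y j) x| ≤ C * 𝔖.kappa m := by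
  intro x _ j hj
  obtain ⟨hFc, hF1, hFd, hAcard⟩ := hF
  have hC : C ≠ 0 := hD.C_pos.ne'
  have hm1 : ContDiff ℝ 1 (merge lab x) := contDiff_merge_right lab x
  have hdj : ContDiff ℝ 1 (fun y => coordGradient f₁ y j) := contDiff_one_coordGradient hD.cd₁ j
  have hdjm : Differentiable ℝ (fun z => coordGradient f₁ (merge lab x z) j) :=
    (hdj.differentiable one_ne_zero).comp (hm1.differentiable one_ne_zero)
  -- the child inserts
  have hF' : 𝔖.Obs (fun z => F (merge lab x z)) A :=
    ⟨hFc.comp hm1, fun z => (gradSq_comp_merge_le lab (hFc.differentiable one_ne_zero) x z).trans (hF1 _),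
      dependsOn_comp_merge_right lab x hFd, hAcard⟩
  have hG' : 𝔖.Obs (fun z => C⁻¹ * coordGradient f₁ (merge lab x z) j) (𝔖.ball 𝔖.r j) := by
    refine ⟨contDiff_const.mul (hdj.comp hm1), fun z => ?_,
      dependsOn_const_mul (dependsOn_comp_merge_right lab x (hD.shell_dep j hj)) C⁻¹, 𝔖.card_ball_le_a j⟩
    rw [gradSq_const_mul hdjm C⁻¹ z]
    have h := (gradSq_comp_merge_le lab (Φ := fun y => coordGradient f₁ y j) (hdj.differentiable one_ne_zero)
      x z).trans (hD.shell_row j hj _)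
    calc C⁻¹ ^ 2 * (coordGradient (fun z => coordGradient f₁ (merge lab x z) j) z
            ⬝ᵥ coordGradient (fun z => coordGradient f₁ (merge lab x z) j) z)
        ≤ C⁻¹ ^ 2 * C ^ 2 := by gcongr
      _ = 1 := by field_simp
  -- separation at level m
  have hsep : ∀ i ∈ A, ∀ k ∈ 𝔖.ball 𝔖.r j, m < 𝔖.d i k := by
    intro i hi k hk
    have h1 := hA1 j hj i hi
    have h2 := 𝔖.mem_ball.mp hk
    have h3 := 𝔖.d_tri i k j
    omega
  have hAdm : 𝔖.Adm m (condPot lab 𝔖.lam f₁ x) (fun z => F (merge lab x z))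
      (fun z => C⁻¹ * coordGradient f₁ (merge lab x z) j) :=
    ⟨𝔖.inClass_condPot hD x, A, 𝔖.ball 𝔖.r j, hF', hG', hsep⟩
  have hκ := 𝔖.abs_cubeCov_le_kappa hAdm
  -- identification of the conditional covariance with the child's cube covariance, and rescaling
  have hFd2 : DependsOn F {i | lab i ≠ 2} := hFd.mono fun i hi => by
    have h := hA0 i (Finset.mem_coe.mp hi)
    show lab i ≠ 2
    rw [h]; decide
  rw [shellCov_grad_eq_cubeCov_condPot 𝔖.S_pos lab 𝔖.lam (hD.cd₁.of_le (by norm_num)) hFc.continuous hD.dep₁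
    hFd2 x j]
  have e : (fun z => coordGradient f₁ (merge lab x z) j)
      = fun z => C * (C⁻¹ * coordGradient f₁ (merge lab x z) j) := by
    funext z
    rw [← mul_assoc, mul_inv_cancel₀ hC, one_mul]
  rw [e, cubeCov_const_mul_right, abs_mul, abs_of_pos hD.C_pos]
  exact mul_le_mul_of_nonneg_left hκ hD.C_pos.le

end Spec

end Split

/-! ## §3 The refinement labelling of `(A, m)` and THE STEP `κ(M) ≤ λ⁻¹ · (a·G(m+2r)) · 2R² · κ(m)²` for `M > 2m + 3r` -/

section Step

namespace Spec

variable (𝔖 : Spec n)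

open Classical in
/-- THE REFINEMENT LABELLING of a support `A` at level `m`: inside `= {d(A,·) ≤ m + r}`, shell
`= {m + r < d(A,·) ≤ m + 2r}`, outside `= {d(A,·) > m + 2r}`.
[folklore] [cite: Martinelli1999, §2.4 p.103 (Def. 2.6, Thm 2.7); MartinelliOlivieri1994] -/
noncomputable def rlab (A : Finset (Fin n)) (m : ℕ) (i : Fin n) : Fin 3 :=
  if ∃ a ∈ A, 𝔖.d a i ≤ m + 𝔖.r then 0 else if ∃ a ∈ A, 𝔖.d a i ≤ m + 2 * 𝔖.r then 1 else 2

variable {A B : Finset (Fin n)} {m M : ℕ}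

/-- Inside block of the refinement labelling: `d(A,·) ≤ m + r`. [cite: Martinelli1999, §2.1 p.98] -/
theorem rlab_eq_zero_iff {i : Fin n} : 𝔖.rlab A m i = 0 ↔ ∃ a ∈ A, 𝔖.d a i ≤ m + 𝔖.r := by
  unfold rlab; split_ifs with h1 h2
  · exact iff_of_true rfl h1
  · exact iff_of_false (by decide) h1
  · exact iff_of_false (by decide) h1

/-- Shell of the refinement labelling: `m + r < d(A,·) ≤ m + 2r`. [cite: Martinelli1999, §2.1 p.98] -/
theorem rlab_eq_one_iff {i : Fin n} :
    𝔖.rlab A m i = 1 ↔ (¬ ∃ a ∈ A, 𝔖.d a i ≤ m + 𝔖.r) ∧ ∃ a ∈ A, 𝔖.d a i ≤ m + 2 * 𝔖.r := by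
  unfold rlab; split_ifs with h1 h2
  · exact iff_of_false (by decide) fun h => h.1 h1
  · exact iff_of_true rfl ⟨h1, h2⟩
  · exact iff_of_false (by decide) fun h => h2 h.2

/-- Outside block of the refinement labelling: `d(A,·) > m + 2r`. [cite: Martinelli1999, §2.1 p.98] -/
theorem rlab_eq_two_iff {i : Fin n} : 𝔖.rlab A m i = 2 ↔ ¬ ∃ a ∈ A, 𝔖.d a i ≤ m + 2 * 𝔖.r := by
  unfold rlab; split_ifs with h1 h2
  · refine iff_of_false (by decide) fun h => h ?_
    obtain ⟨a, ha, hd⟩ := h1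
    exact ⟨a, ha, hd.trans (by omega)⟩
  · exact iff_of_false (by decide) fun h => h h2
  · exact iff_of_true rfl h2

/-- `A ⊆ inside`. [cite: Martinelli1999, §2.1 p.98] -/
theorem rlab_of_mem {i : Fin n} (hi : i ∈ A) : 𝔖.rlab A m i = 0 :=
  𝔖.rlab_eq_zero_iff.mpr ⟨i, hi, by rw [𝔖.d_self]; exact Nat.zero_le _⟩

/-- The refinement labelling is WIDE (triangle inequality). [cite: Martinelli1999, §2.1 p.98] -/
theorem wide_rlab : 𝔖.Wide (𝔖.rlab A m) := by
  intro i k hi hk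
  obtain ⟨a, ha, hai⟩ := 𝔖.rlab_eq_zero_iff.mp hi
  have hk' := 𝔖.rlab_eq_two_iff.mp hk
  have hak : ¬ 𝔖.d a k ≤ m + 2 * 𝔖.r := fun h => hk' ⟨a, ha, h⟩
  have htri := 𝔖.d_tri a i k
  omega

/-- The shell is more than `m + r` away from `A`. [cite: Martinelli1999, §2.1 p.98] -/
theorem rlab_shell_far {j : Fin n} (hj : 𝔖.rlab A m j = 1) : ∀ i ∈ A, m + 𝔖.r < 𝔖.d i j := by
  intro i hi
  have h := (𝔖.rlab_eq_one_iff.mp hj).1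
  by_contra hc
  exact h ⟨i, hi, not_lt.mp hc⟩

/-- A support `B` at distance `> M > 2m + 3r` from `A` lies in the outside block …
[cite: Martinelli1999, §2.1 p.98] -/
theorem rlab_of_sep (hsep : ∀ i ∈ A, ∀ k ∈ B, M < 𝔖.d i k) (hM : 2 * m + 3 * 𝔖.r < M) {k : Fin n}
    (hk : k ∈ B) : 𝔖.rlab A m k = 2 := by
  refine 𝔖.rlab_eq_two_iff.mpr fun ⟨a, ha, hd⟩ => ?_
  have := hsep a ha k hk
  omega

/-- … and more than `m + r` away from the shell. [cite: Martinelli1999, §2.1 p.98] -/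
theorem rlab_shell_far' (hsep : ∀ i ∈ A, ∀ k ∈ B, M < 𝔖.d i k) (hM : 2 * m + 3 * 𝔖.r < M) {j : Fin n}
    (hj : 𝔖.rlab A m j = 1) : ∀ k ∈ B, m + 𝔖.r < 𝔖.d k j := by
  intro k hk
  obtain ⟨a, ha, haj⟩ := (𝔖.rlab_eq_one_iff.mp hj).2
  have hak := hsep a ha k hk
  have htri := 𝔖.d_tri a j k
  rw [𝔖.d_comm k j]
  omega

/-- The shell has at most `#A · G(m + 2r)` coordinates. [cite: Martinelli1999, §2.1 p.98] -/
theorem card_shell_le :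
    (Finset.univ.filter fun j => 𝔖.rlab A m j = 1).card ≤ A.card * 𝔖.growth (m + 2 * 𝔖.r) := by
  classical
  have hsub : (Finset.univ.filter fun j => 𝔖.rlab A m j = 1) ⊆ A.biUnion fun a => 𝔖.ball (m + 2 * 𝔖.r) a := by
    intro j hj
    obtain ⟨a, ha, haj⟩ := (𝔖.rlab_eq_one_iff.mp (Finset.mem_filter.mp hj).2).2
    rw [Finset.mem_biUnion]
    refine ⟨a, ha, 𝔖.mem_ball.mpr ?_⟩
    rwa [𝔖.d_comm]
  refine (Finset.card_le_card hsub).trans (Finset.card_biUnion_le.trans ?_)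
  have h := Finset.sum_le_card_nsmul A (fun a => (𝔖.ball (m + 2 * 𝔖.r) a).card) (𝔖.growth (m + 2 * 𝔖.r))
    fun a _ => 𝔖.card_ball_le_growth _ a
  simpa using h

/-- **THE STEP (PROVED): the abstract doubling recursion of the covariance profile.**  For every `M > 2m + 3r`,
`κ(M) ≤ λ⁻¹ · (a · G(m + 2r)) · 2R² · κ(m)²`: an admissible triple at separation `M` is split along the
refinement labelling of `(supp F, m)`; G8 ∕ module V's `abs_cubeCov_le_doubling_profile` bounds `|Cov_K(F,H)|` by
`λ⁻¹ · #shell · C_F C_H · κ₁ κ₂` given the shell-indexed conditional covariance bounds, and `side_bound` supplies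
those with `κ₁ = κ₂ = κ(m)`, `C_F = 2R` (F-side), `C_H = R` (H-side, swapped labelling) because the children are
admissible at separation `m` for the SAME spec.
[cite: BrascampLieb1976, Thm 4.1; FriedliVelenik2017, Exercise 3.11 (3.26); GlimmJaffe1987, Cor. 4.3.4 (proof); Martinelli1999, §2.4 p.103 (Def. 2.6, Thm 2.7); MartinelliOlivieri1994] -/
theorem kappa_step (hM : 2 * m + 3 * 𝔖.r < M) :
    𝔖.kappa M ≤ 𝔖.lam⁻¹ * ((𝔖.a * 𝔖.growth (m + 2 * 𝔖.r) : ℕ) : ℝ) * (2 * 𝔖.R ^ 2) * 𝔖.kappa m ^ 2 := by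
  have hlam := 𝔖.lam_pos
  have hκ := 𝔖.kappa_nonneg m
  refine 𝔖.kappa_le_of_forall (by positivity) fun f F H hAdm => ?_
  obtain ⟨hfC, A, B, hF, hH, hsep⟩ := hAdm
  have hw : 𝔖.Wide (𝔖.rlab A m) := 𝔖.wide_rlab
  have hDlo := 𝔖.sideData_lo hfC hw
  have hDhi := 𝔖.sideData_hi hfC hw
  -- the two one-sided bounds
  have hβ := 𝔖.side_bound hDlo (m := m) hF (fun i hi => 𝔖.rlab_of_mem hi) fun j hj => 𝔖.rlab_shell_far hj
  have hγ' := 𝔖.side_bound hDhi (m := m) hH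
    (fun k hk => (lswap_spec _ k).1.mpr (𝔖.rlab_of_sep hsep hM hk))
    (fun j hj => 𝔖.rlab_shell_far' hsep hM ((lswap_spec _ j).2.1.mp hj))
  have hγ : ∀ x ∈ cube n 𝔖.S, ∀ j, 𝔖.rlab A m j = 1 →
      |shellCov (𝔖.rlab A m) (fHi (𝔖.rlab A m) f) 𝔖.S H (fun y => coordGradient (fHi (𝔖.rlab A m) f) y j) x|
        ≤ 𝔖.R * 𝔖.kappa m := by
    intro x hx j hj
    rw [← shellCov_lswap]
    exact hγ' x hx j ((lswap_spec _ j).2.1.mpr hj)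
  -- the hypotheses of the doubling theorem
  have hB' : HessianBound (fLo (𝔖.rlab A m) f + fHi (𝔖.rlab A m) f) 𝔖.lam := by
    rw [fLo_add_fHi]; exact hfC.2.1
  have hFd : DependsOn F {i | 𝔖.rlab A m i = 0} :=
    hF.2.2.1.mono fun i hi => 𝔖.rlab_of_mem (Finset.mem_coe.mp hi)
  have hHd : DependsOn H {i | 𝔖.rlab A m i = 2} :=
    hH.2.2.1.mono fun k hk => 𝔖.rlab_of_sep hsep hM (Finset.mem_coe.mp hk)
  have key := abs_cubeCov_le_doubling_profile 𝔖.S_pos 𝔖.lam_pos (𝔖.rlab A m) hDlo.cd₁ hDlo.cd₂ hB' hF.1 hH.1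
    hDlo.dep₁ hFd hDlo.dep₂ hHd (κ₁ := 𝔖.kappa m) (κ₂ := 𝔖.kappa m) (C_F := 2 * 𝔖.R) (C_H := 𝔖.R) hκ hκ
    (by have := 𝔖.R_pos; positivity) 𝔖.R_pos.le hβ hγ
  rw [fLo_add_fHi] at key
  -- counting the shell
  have hN : (((Finset.univ.filter fun j => 𝔖.rlab A m j = 1).card : ℕ) : ℝ)
      ≤ ((𝔖.a * 𝔖.growth (m + 2 * 𝔖.r) : ℕ) : ℝ) := by
    have h1 := 𝔖.card_shell_le (A := A) (m := m)
    have h2 : A.card * 𝔖.growth (m + 2 * 𝔖.r) ≤ 𝔖.a * 𝔖.growth (m + 2 * 𝔖.r) :=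
      Nat.mul_le_mul_right _ hF.2.2.2
    exact_mod_cast h1.trans h2
  have hR := 𝔖.R_pos
  calc |cubeCov f 𝔖.S F H|
      ≤ 𝔖.lam⁻¹ * ((Finset.univ.filter fun j => 𝔖.rlab A m j = 1).card : ℝ) * (2 * 𝔖.R * 𝔖.R)
          * (𝔖.kappa m * 𝔖.kappa m) := key
    _ ≤ 𝔖.lam⁻¹ * ((𝔖.a * 𝔖.growth (m + 2 * 𝔖.r) : ℕ) : ℝ) * (2 * 𝔖.R * 𝔖.R)
          * (𝔖.kappa m * 𝔖.kappa m) := by gcongr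
    _ = 𝔖.lam⁻¹ * ((𝔖.a * 𝔖.growth (m + 2 * 𝔖.r) : ℕ) : ℝ) * (2 * 𝔖.R ^ 2) * 𝔖.kappa m ^ 2 := by ring

end Spec

end Step

/-! ## §4 THE BARRIER: the quadratic recursion along dyadic scales, modulo ONE seed -/

section Barrier

/-- `b_{j+1} ≤ b_j²`, `0 ≤ b_j`, `b_0 ≤ ρ` ⇒ `b_j ≤ ρ^{2^j}`.
[cite: Martinelli1999, §2.4 p.103 (Def. 2.6, Thm 2.7); MartinelliOlivieri1994] -/
theorem sq_barrier {b : ℕ → ℝ} (hb : ∀ j, 0 ≤ b j) (hstep : ∀ j, b (j + 1) ≤ b j ^ 2) {ρ : ℝ}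
    (hseed : b 0 ≤ ρ) : ∀ j, b j ≤ ρ ^ 2 ^ j := by
  intro j
  induction j with
  | zero => simpa using hseed
  | succ j ih =>
    calc b (j + 1) ≤ b j ^ 2 := hstep j
      _ ≤ (ρ ^ 2 ^ j) ^ 2 := pow_le_pow_left₀ (hb j) ih 2
      _ = ρ ^ 2 ^ (j + 1) := by rw [← pow_mul, ← pow_succ]

namespace Spec

variable (𝔖 : Spec n)

/-- The recursion constant `c = 2R²/λ`.
[folklore] [cite: BrascampLieb1976, Thm 4.1; FriedliVelenik2017, Exercise 3.11 (3.26); GlimmJaffe1987, Cor. 4.3.4 (proof)] -/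
noncomputable def cst : ℝ := 𝔖.lam⁻¹ * (2 * 𝔖.R ^ 2)

/-- `0 < c`. [cite: BrascampLieb1976, Thm 4.1; FriedliVelenik2017, Exercise 3.11 (3.26); GlimmJaffe1987, Cor. 4.3.4 (proof)] -/
theorem cst_pos : 0 < 𝔖.cst := by
  have := 𝔖.lam_pos; have := 𝔖.R_pos; unfold cst; positivity

/-- **THE BARRIER MODULO ONE SEED (PROVED).**  Along the dyadic scales `s_{j+1} = 2 s_j + 3r + 1`, if the shell
counts grow at most geometrically, `a·G(s_j + 2r) ≤ A q^j`, then the renormalised profile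
`b_j = c A q^{j+1} κ(s_j)` obeys `b_{j+1} ≤ b_j²` (THE STEP), so ONE smallness condition at ONE scale,
`c A q κ(s_0) ≤ ρ`, yields `κ(s_j) ≤ ρ^{2^j} / (c A q^{j+1})` at every scale — for `ρ < 1` a super-exponential decay
in `j`, i.e. exponential in the scale `s_j ≍ 2^j`, with constants uniform in `n`.  The seed is a HYPOTHESIS.
[cite: Martinelli1999, §2.4 p.103 (Def. 2.6, Thm 2.7); MartinelliOlivieri1994; HelfferSjostrand1994; Ledoux2001, Prop. 6.2 p.190] -/
theorem kappa_barrier (s : ℕ → ℕ) (hs : ∀ j, s (j + 1) = 2 * s j + 3 * 𝔖.r + 1) {A q ρ : ℝ} (hA : 0 < A)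
    (hq : 0 < q) (hN : ∀ j, ((𝔖.a * 𝔖.growth (s j + 2 * 𝔖.r) : ℕ) : ℝ) ≤ A * q ^ j)
    (hseed : 𝔖.cst * A * q * 𝔖.kappa (s 0) ≤ ρ) :
    ∀ j, 𝔖.kappa (s j) ≤ ρ ^ 2 ^ j / (𝔖.cst * A * q ^ (j + 1)) := by
  have hc := 𝔖.cst_pos
  set b : ℕ → ℝ := fun j => 𝔖.cst * A * q ^ (j + 1) * 𝔖.kappa (s j) with hb
  have hb0 : ∀ j, 0 ≤ b j := fun j => by
    have := 𝔖.kappa_nonneg (s j); simp only [hb]; positivity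
  have hbstep : ∀ j, b (j + 1) ≤ b j ^ 2 := by
    intro j
    have hM : 2 * s j + 3 * 𝔖.r < s (j + 1) := by rw [hs j]; exact Nat.lt_succ_self _
    have h1 := 𝔖.kappa_step hM
    have hκ := 𝔖.kappa_nonneg (s j)
    have h2 : 𝔖.kappa (s (j + 1)) ≤ 𝔖.cst * (A * q ^ j) * 𝔖.kappa (s j) ^ 2 := by
      refine h1.trans ?_
      unfold cst
      have hlam := 𝔖.lam_pos
      have := hN j
      calc 𝔖.lam⁻¹ * ((𝔖.a * 𝔖.growth (s j + 2 * 𝔖.r) : ℕ) : ℝ) * (2 * 𝔖.R ^ 2) * 𝔖.kappa (s j) ^ 2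
          ≤ 𝔖.lam⁻¹ * (A * q ^ j) * (2 * 𝔖.R ^ 2) * 𝔖.kappa (s j) ^ 2 := by gcongr
        _ = 𝔖.lam⁻¹ * (2 * 𝔖.R ^ 2) * (A * q ^ j) * 𝔖.kappa (s j) ^ 2 := by ring
    simp only [hb]
    calc 𝔖.cst * A * q ^ (j + 1 + 1) * 𝔖.kappa (s (j + 1))
        ≤ 𝔖.cst * A * q ^ (j + 1 + 1) * (𝔖.cst * (A * q ^ j) * 𝔖.kappa (s j) ^ 2) := by
          have : 0 ≤ 𝔖.cst * A * q ^ (j + 1 + 1) := by positivity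
          exact mul_le_mul_of_nonneg_left h2 this
      _ = (𝔖.cst * A * q ^ (j + 1) * 𝔖.kappa (s j)) ^ 2 := by ring
  have hseed' : b 0 ≤ ρ := by simpa [hb] using hseed
  intro j
  have h := sq_barrier hb0 hbstep hseed' j
  simp only [hb] at h
  have hpos : 0 < 𝔖.cst * A * q ^ (j + 1) := by positivity
  rw [le_div_iff₀ hpos]
  calc 𝔖.kappa (s j) * (𝔖.cst * A * q ^ (j + 1)) = 𝔖.cst * A * q ^ (j + 1) * 𝔖.kappa (s j) := by ring
    _ ≤ ρ ^ 2 ^ j := h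

/-- Read-out between scales: the profile is non-increasing, so `κ(m) ≤ ρ^{2^j} / (c A q^{j+1})` for every `m ≥ s_j`.
[cite: Martinelli1999, §2.4 p.103 (Def. 2.6, Thm 2.7); MartinelliOlivieri1994; HelfferSjostrand1994; Ledoux2001, Prop. 6.2 p.190] -/
theorem kappa_barrier_of_le (s : ℕ → ℕ) (hs : ∀ j, s (j + 1) = 2 * s j + 3 * 𝔖.r + 1) {A q ρ : ℝ} (hA : 0 < A)
    (hq : 0 < q) (hN : ∀ j, ((𝔖.a * 𝔖.growth (s j + 2 * 𝔖.r) : ℕ) : ℝ) ≤ A * q ^ j)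
    (hseed : 𝔖.cst * A * q * 𝔖.kappa (s 0) ≤ ρ) {j m : ℕ} (hm : s j ≤ m) :
    𝔖.kappa m ≤ ρ ^ 2 ^ j / (𝔖.cst * A * q ^ (j + 1)) :=
  (𝔖.kappa_antitone hm).trans (𝔖.kappa_barrier s hs hA hq hN hseed j)

end Spec

end Barrier

/-! ## §5 Non-vacuity: specs from connected graphs; the class contains the `λ`-Gaussian; every level is admissible -/

section Models

namespace Spec

/-- A SPEC FROM A CONNECTED GRAPH on the coordinates (e.g. the nearest-neighbour graph of a discrete torus, one
coordinate per site ∕ link component): `d` = graph distance, support budget `a` = the volume growth `G(r)` at the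
range (the smallest admissible value). [folklore] [cite: Martinelli1999, §2.1 p.98] -/
noncomputable def ofGraph (G : SimpleGraph (Fin n)) (hG : G.Connected) (r : ℕ) (S lam R : ℝ) (hS : 0 < S)
    (hlam : 0 < lam) (hle : lam ≤ R) : Spec n where
  d i k := G.dist i k
  r := r
  S := S
  lam := lam
  R := R
  a := Finset.univ.sup fun k => (Finset.univ.filter fun i => G.dist i k ≤ r).card
  d_self _ := SimpleGraph.dist_self
  d_comm _ _ := SimpleGraph.dist_comm
  d_tri _ _ _ := hG.dist_triangle
  S_pos := hS
  lam_pos := hlam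
  lam_le := hle
  growth_le k :=
    Finset.le_sup (f := fun k => (Finset.univ.filter fun i => G.dist i k ≤ r).card) (Finset.mem_univ k)

variable (𝔖 : Spec n)

/-- The windowed `λ`-Gaussian potential `q(z) = (λ/2)|z|²`. [folklore] [cite: BrascampLieb1976, Thm 4.1] -/
noncomputable def gauss : (Fin n → ℝ) → ℝ := fun z => 𝔖.lam / 2 * ∑ j ∈ Finset.univ, z j ^ 2

/-- `∂_k q(y) = λ y_k`. [cite: Spivak1965, Thm 2-3] -/
theorem coordGradient_gauss (y : Fin n → ℝ) (k : Fin n) : coordGradient 𝔖.gauss y k = 𝔖.lam * y k := by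
  show fderiv ℝ 𝔖.gauss y (Pi.single k 1) = _
  unfold gauss
  rw [fderiv_quadReg_apply]
  congr 1
  simp only [Pi.single_apply, mul_ite, mul_one, mul_zero, Finset.sum_ite_eq', Finset.mem_univ, if_true]

/-- `q` is `λ`-convex: the first-order inequality holds with equality. [cite: BrascampLieb1976, Thm 4.1] -/
theorem hessianBound_gauss : HessianBound 𝔖.gauss 𝔖.lam := by
  refine hessianBound_of_firstOrder (contDiff_quadReg 𝔖.lam _) fun x y => le_of_eq ?_
  show 𝔖.gauss x + fderiv ℝ 𝔖.gauss x (y - x) + 𝔖.lam / 2 * ((y - x) ⬝ᵥ (y - x)) = 𝔖.gauss y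
  unfold gauss
  rw [fderiv_quadReg_apply]
  simp only [dotProduct, Pi.sub_apply, Finset.mul_sum, ← Finset.sum_add_distrib]
  exact Finset.sum_congr rfl fun j _ => by ring

/-- **The class `𝔐` is inhabited**: the `λ`-Gaussian is in it (this is where `λ ≤ R` is used).
[cite: BrascampLieb1976, Thm 4.1; Martinelli1999, §2.1 p.98] -/
theorem inClass_gauss : 𝔖.InClass 𝔖.gauss := by
  have hgrad : ∀ k, (fun y => coordGradient 𝔖.gauss y k) = fun y => 𝔖.lam * y k :=
    fun k => funext fun y => 𝔖.coordGradient_gauss y k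
  refine ⟨contDiff_quadReg 𝔖.lam _, 𝔖.hessianBound_gauss, fun k => ?_, fun k y => ?_⟩
  · rw [hgrad k]
    intro y y' h
    show 𝔖.lam * y k = 𝔖.lam * y' k
    rw [h k (Finset.mem_coe.mpr (𝔖.self_mem_ball _ k))]
  · rw [hgrad k, gradSq_const_mul_apply]
    exact pow_le_pow_left₀ 𝔖.lam_pos.le 𝔖.lam_le 2

/-- The zero insert with empty support is admissible. [cite: Martinelli1999, §2.4 p.103 (Def. 2.6)] -/
theorem obs_zero : 𝔖.Obs (fun _ => 0) ∅ := by
  refine ⟨contDiff_const, fun y => ?_, fun _ _ _ => rfl, by simp⟩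
  have h : coordGradient (fun _ : Fin n → ℝ => (0 : ℝ)) y = 0 := by
    funext i; simp [coordGradient]
  rw [h]; simp

/-- **Every level is admissible** (so `κ` is the supremum of a set that is never reduced to the adjoined `0` for a
trivial reason): `(q, 0, 0) ∈ Adm m` for all `m`. [cite: Martinelli1999, §2.4 p.103 (Def. 2.6)] -/
theorem adm_gauss_zero (m : ℕ) : 𝔖.Adm m 𝔖.gauss (fun _ => 0) (fun _ => 0) :=
  ⟨𝔖.inClass_gauss, ∅, ∅, 𝔖.obs_zero, 𝔖.obs_zero, fun _ hi => (Finset.notMem_empty _ hi).elim⟩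

end Spec

end Models

end Literature.MathematicalPhysics.QuantumFieldTheory.Balaban1983to89.T4CubeShellProfile
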